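import Mathlib.Combinatorics.SetFamily.FourFunctions
import Mathlib.Analysis.SpecialFunctions.Pow.Asymptotics
import Mathlib.Data.Nat.Choose.Cast
import Literature.Computability.Complexity.RossmanMonotoneClique
import Literature.Computability.Complexity.Rossman2008CliqueProofs
import HarnessLib

/-!
# Rossman 2010, Lemma 23: planted versus conditioned `k`-cliques at the threshold (proof)

B. Rossman, *The monotone complexity of k-clique on random graphs*, FOCS 2010 [Rossman2010]
(full version of 2009-11-05, the held text `paper:doi-10-1109-focs-2010-26`), Appendix B,
**Lemma 23** (p. 13, proof pp. 13–14): for `p ∈ Θ(n^{-2/(k-1)})`, `G = G(n,p)` and a uniformly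
random `k`-set `A`, the laws of `G | {ω_k(G) = 1}` and of `G ∪ K_A | {ω_k(G) = 0}` have total
variation distance `o(1)`.

This file DISCHARGES the named fact `Rossman2010_plantedVsConditioned` of
`RossmanMonotoneClique.lean` (`Rossman2010_plantedVsConditioned_holds`), in the finite-sum model
of `G(n,p)` used there (`gnpWeight`, `gnpProb`, `cliqueCount`, `plantClique`,
`condOneCliqueLaw`, `plantedCliqueFreeLaw`); the sibling `RossmanMonotoneCliqueProofs.lean`
holds the proof of Theorem 3 (`Rossman2010_upperBound_holds`). No new definitions; the helper
lemmas live in the sub-namespace `Rossman2010L23`.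

## The printed proof and how it is mirrored

Write `ω = ω_k`, `K = C(k,2)`, `N = C(n,k)`, `Z = Pr[ω(G) = 0]`, `O = Pr[ω(G) = 1]`, and
`P(H) = Pr[G = H | ω = 1]`, `Q(H) = Pr[G ∪ K_A = H | ω(G) = 0]`. The paper (p. 13) splits
`TV = Pr[ω(G ∪ K_A) ≥ 2 | ω(G) = 0] + ∑_{ω(H)=1} |P(H) - Q(H)|`, computes the ratio `Q(H)/P(H)`
by Bayes' theorem, and shows (a) `Pr[ω(G ∪ K_A) ≥ 2 | ω(G) = 0] = o(1)` (Harris' inequality and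
the count `∑_{j=2}^{k-1} C(k,j) C(n-k,k-j) p^{K - C(j,2)} = O(1/n)`), (b)
`Pr[ω(G ∪ K_A) = 1] / Pr[ω(G) = 0] = Θ(1)` using `Pr[ω(G) = 0] ≥ Ω(1)` ("since `p` is a threshold
function"), (c) `Pr[ω(G) = 0 | G ∪ K_A = H] = 1 - p^K`.

Here, in the same order of ideas:

* `Rossman2010L23.pow_mul_sum_agreeOff` — resampling the edges of a fixed edge set
  (independence), the computation behind (c) and the Bayes step;
* `Rossman2010L23.pow_mul_inner_eq` — for `ω(H) = 1`:
  `p^K ∑_A Pr[ω(G) = 0 ∧ G ∪ K_A = H] = Pr[G = H] (1 - p^K)`, i.e. `Q(H) = r · P(H)` with a ratio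
  `r` independent of `H`;
* `Rossman2010L23.tv_eq` — hence the paper's decomposition becomes the EXACT identity
  `TV = 2 · Pr[ω(G ∪ K_A) ≠ 1 | ω(G) = 0]` (`Rossman2010L23.tv_algebra` is the real arithmetic);
* `Rossman2010L23.gnpProb_bad_le` — (a), proved for the JOINT event
  `{ω(G) = 0 ∧ ω(G ∪ K_A) ≠ 1}` by the union bound over second cliques `B`,
  `2 ≤ |A ∩ B| ≤ k - 1`, `K_B ∖ K_A ⊆ G` (so Harris' inequality is not needed at this point;
  `C(n-k,k-j)` is relaxed to `C(n,k-j)`);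
* `Rossman2010L23.pow_le_gnpProb_cliqueCount_eq_zero` — the "`Ω(1)`" of (b):
  `Pr[ω(G(n,q)) = 0] ≥ (1 - q^K)^N`, by **Harris' inequality** (positive correlation of decreasing
  events under a product measure), obtained from Mathlib's FKG inequality `fkg` on the order dual
  of the Boolean lattice of edge vectors (`Rossman2010L23.harris_antitone`; the `G(n,q)` weights
  are log-modular, `Rossman2010L23.gnpWeight_inf_mul_sup`);
* `Rossman2010_plantedVsConditioned_holds` — the threshold asymptotics: from
  `p ≤ c · n^{-2/(k-1)}` eventually, `N p^K ≤ c^K`, so `Z ≥ (1 - p^K)^N ≥ exp(-2 c^K)`, and each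
  term `C(k,j) C(n,k-j) p^{K-C(j,2)} ≤ C(k,j) c^{K-C(j,2)} n^{-j(k-j)/(k-1)} → 0`; therefore
  `TV ≤ 2 exp(2 c^K) ∑_j (…) → 0`.

## References

* [Rossman2010] B. Rossman, The monotone complexity of k-clique on random graphs, FOCS 2010,
  193–201, doi:10.1109/focs.2010.26; SIAM J. Comput. 43 (2014) 256–279 — Lemma 23, App. B.
* T. E. Harris, A lower bound for the critical probability in a certain percolation process,
  Proc. Cambridge Philos. Soc. 56 (1960) 13–20 (Harris' inequality); C. M. Fortuin,
  P. W. Kasteleyn, J. Ginibre, Comm. Math. Phys. 22 (1971) 89–103 (FKG; Mathlib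
  `Mathlib.Combinatorics.SetFamily.FourFunctions`, `fkg`).
* S. Janson, T. Łuczak, A. Ruciński, Random Graphs (2000), Thm. 2.18 / Ch. 3 (the threshold
  `n^{-2/(k-1)}` for `k`-cliques and the lower bound `Pr[X = 0] ≥ exp(-μ/(1 - max p_i))`-type
  estimates; only the elementary Harris bound is used here).
-/

noncomputable section

namespace Literature.Computability.Complexity

open Finset Filter Asymptotics
open scoped _root_.Topology

namespace Rossman2010L23

variable {n : ℕ}

/-! ### Combinatorics of clique vectors, containment and planting -/

/-- `K_{A ∩ B} = K_A ∩ K_B` edgewise. [folklore] -/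
theorem cliqueVec_inter (A B : Finset (Fin n)) (e : (⊤ : SimpleGraph (Fin n)).edgeSet) :
    cliqueVec (A ∩ B) e = (cliqueVec A e && cliqueVec B e) := by
  simp only [cliqueVec, mem_inter]
  rw [Bool.eq_iff_iff]
  simp only [decide_eq_true_eq, Bool.and_eq_true]
  exact ⟨fun h => ⟨fun v hv => (h v hv).1, fun v hv => (h v hv).2⟩,
    fun h v hv => ⟨h.1 v hv, h.2 v hv⟩⟩

/-- An edge inside both `A` and `B` forces `|A ∩ B| ≥ 2`. [folklore] -/
theorem two_le_card_inter_of_cliqueVec {A B : Finset (Fin n)}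
    {e : (⊤ : SimpleGraph (Fin n)).edgeSet} (hA : cliqueVec A e = true)
    (hB : cliqueVec B e = true) : 2 ≤ #(A ∩ B) := by
  obtain ⟨e, he⟩ := e
  induction e using Sym2.ind with
  | h u v =>
    have huv : u ≠ v := by simpa using he
    simp only [cliqueVec, Sym2.mem_iff, forall_eq_or_imp, forall_eq, decide_eq_true_eq] at hA hB
    rw [show (2 : ℕ) = 1 + 1 from rfl, Nat.add_one_le_iff, one_lt_card]
    exact ⟨u, mem_inter.2 ⟨hA.1, hB.1⟩, v, mem_inter.2 ⟨hA.2, hB.2⟩, huv⟩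

/-- Containment `K_A ⊆ x` is monotone in `x`. [folklore] -/
theorem sub_mono {A : Finset (Fin n)} {x y : (⊤ : SimpleGraph (Fin n)).edgeSet → Bool}
    (hxy : x ≤ y) (hx : ∀ e, cliqueVec A e = true → x e = true) :
    ∀ e, cliqueVec A e = true → y e = true := by
  intro e he
  have h1 := hxy e
  rw [hx e he] at h1
  exact top_le_iff.1 h1

/-- `x ⊆ x ∪ K_A`. [folklore] -/
theorem le_plantClique (A : Finset (Fin n)) (x : (⊤ : SimpleGraph (Fin n)).edgeSet → Bool) :
    x ≤ plantClique A x := fun e => by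
  simp only [plantClique]
  exact Bool.left_le_or _ _

/-- `K_A ⊆ x ∪ K_A`. [folklore] -/
theorem sub_plantClique (A : Finset (Fin n)) (x : (⊤ : SimpleGraph (Fin n)).edgeSet → Bool) :
    ∀ e, cliqueVec A e = true → plantClique A x e = true := by
  intro e he
  simp [plantClique, he]

/-- `x ∪ K_A = H` iff `K_A ⊆ H` and `x` agrees with `H` off `K_A`. [folklore] -/
theorem plantClique_eq_iff (A : Finset (Fin n)) (x H : (⊤ : SimpleGraph (Fin n)).edgeSet → Bool) :
    plantClique A x = H ↔
      (∀ e, cliqueVec A e = true → H e = true) ∧ ∀ e, cliqueVec A e = false → x e = H e := by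
  constructor
  · rintro rfl
    exact ⟨sub_plantClique A x, fun e he => by simp [plantClique, he]⟩
  · rintro ⟨h1, h2⟩
    funext e
    cases he : cliqueVec A e
    · simpa [plantClique, he] using h2 e he
    · simpa [plantClique, he] using (h1 e he).symm

/-- A clique `B` of `x ∪ K_A` meeting `A` in at most one vertex is a clique of `x`. [folklore] -/
theorem sub_of_sub_plantClique_of_card_le_one {A B : Finset (Fin n)}
    {x : (⊤ : SimpleGraph (Fin n)).edgeSet → Bool}
    (hB : ∀ e, cliqueVec B e = true → plantClique A x e = true) (hAB : #(A ∩ B) ≤ 1) :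
    ∀ e, cliqueVec B e = true → x e = true := by
  intro e he
  have h := hB e he
  simp only [plantClique, Bool.or_eq_true] at h
  rcases h with h | h
  · exact h
  · exact absurd (two_le_card_inter_of_cliqueVec h he) (by omega)

/-- A clique `B` of `x ∪ K_A` has all its edges outside `K_A` in `x`. [folklore] -/
theorem sub_diff_of_sub_plantClique {A B : Finset (Fin n)}
    {x : (⊤ : SimpleGraph (Fin n)).edgeSet → Bool}
    (hB : ∀ e, cliqueVec B e = true → plantClique A x e = true) :
    ∀ e, cliqueVec B e = true → cliqueVec A e = false → x e = true := by
  intro e he hA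
  simpa [plantClique, hA] using hB e he

/-! ### The clique count `ω_k` through containment -/

/-- Unfolding `cliqueCount`: the `k`-cliques of `x` are the `k`-sets `A` with `K_A ⊆ x`.
[folklore] -/
theorem cliqueCount_eq (k : ℕ) (x : (⊤ : SimpleGraph (Fin n)).edgeSet → Bool) :
    cliqueCount n k x =
      #((powersetCard k (univ : Finset (Fin n))).filter
        fun A => ∀ e, cliqueVec A e = true → x e = true) := rfl

/-- `ω_k(x) = 0` iff no `k`-set is a clique of `x`. [folklore] -/
theorem cliqueCount_eq_zero_iff' (k : ℕ) (x : (⊤ : SimpleGraph (Fin n)).edgeSet → Bool) :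
    cliqueCount n k x = 0 ↔ ∀ A ∈ powersetCard k (univ : Finset (Fin n)),
      ¬ ∀ e, cliqueVec A e = true → x e = true := by
  rw [cliqueCount_eq, card_eq_zero, filter_eq_empty_iff]

/-- A `k`-set which is a clique of `x` makes `ω_k(x) ≠ 0`. [folklore] -/
theorem cliqueCount_ne_zero_of_sub {k : ℕ} {x : (⊤ : SimpleGraph (Fin n)).edgeSet → Bool}
    {A : Finset (Fin n)} (hA : A ∈ powersetCard k (univ : Finset (Fin n)))
    (hx : ∀ e, cliqueVec A e = true → x e = true) : cliqueCount n k x ≠ 0 := by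
  rw [Ne, cliqueCount_eq_zero_iff']
  exact fun h => h A hA hx

/-- `ω_k(x ∪ K_A) ≠ 0` for a `k`-set `A`. [folklore] -/
theorem cliqueCount_plantClique_ne_zero {k : ℕ} {A : Finset (Fin n)}
    (hA : A ∈ powersetCard k (univ : Finset (Fin n)))
    (x : (⊤ : SimpleGraph (Fin n)).edgeSet → Bool) : cliqueCount n k (plantClique A x) ≠ 0 :=
  cliqueCount_ne_zero_of_sub hA (sub_plantClique A x)

/-- `ω_k(x) = 1` iff the `k`-cliques of `x` form a singleton `{B}`. [folklore] -/
theorem cliqueCount_eq_one_iff (k : ℕ) (x : (⊤ : SimpleGraph (Fin n)).edgeSet → Bool) :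
    cliqueCount n k x = 1 ↔ ∃ B : Finset (Fin n), ∀ A : Finset (Fin n),
      (A ∈ powersetCard k (univ : Finset (Fin n)) ∧ ∀ e, cliqueVec A e = true → x e = true) ↔
        A = B := by
  rw [cliqueCount_eq, card_eq_one]
  refine exists_congr fun B => ?_
  rw [Finset.ext_iff]
  simp only [mem_filter, mem_singleton]

/-- If `ω_k(x ∪ K_A) ≠ 1` for a `k`-set `A`, some other `k`-set is a clique of `x ∪ K_A`.
[folklore] -/
theorem exists_ne_sub_plantClique {k : ℕ} {A : Finset (Fin n)}
    (hA : A ∈ powersetCard k (univ : Finset (Fin n)))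
    {x : (⊤ : SimpleGraph (Fin n)).edgeSet → Bool} (h1 : cliqueCount n k (plantClique A x) ≠ 1) :
    ∃ B ∈ powersetCard k (univ : Finset (Fin n)), B ≠ A ∧
      ∀ e, cliqueVec B e = true → plantClique A x e = true := by
  have h0 := cliqueCount_plantClique_ne_zero hA x
  rw [cliqueCount_eq] at h0 h1
  have h2 : 1 < #((powersetCard k (univ : Finset (Fin n))).filter
      fun B => ∀ e, cliqueVec B e = true → plantClique A x e = true) := by omega
  obtain ⟨a, ha, b, hb, hab⟩ := one_lt_card.1 h2
  rw [mem_filter] at ha hb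
  by_cases haA : a = A
  · subst haA
    exact ⟨b, hb.1, fun h => hab (h ▸ rfl), hb.2⟩
  · exact ⟨a, ha.1, haA, ha.2⟩

/-- Two distinct `k`-sets meet in fewer than `k` vertices. [folklore] -/
theorem card_inter_lt_of_ne {k : ℕ} {A B : Finset (Fin n)}
    (hA : A ∈ powersetCard k (univ : Finset (Fin n)))
    (hB : B ∈ powersetCard k (univ : Finset (Fin n))) (hne : B ≠ A) : #(A ∩ B) < k := by
  have hAk := (mem_powersetCard.1 hA).2
  have hBk := (mem_powersetCard.1 hB).2
  by_contra hlt
  push Not at hlt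
  have h1 : A ∩ B = A := eq_of_subset_of_card_le inter_subset_left (by omega)
  have h2 : A ⊆ B := by rw [← h1]; exact inter_subset_right
  exact hne (eq_of_subset_of_card_le h2 (by omega)).symm


/-! ### `G(n,q)` calculus: log-modularity, resampling, union bound -/

/-- Log-modularity of the product measure `G(n,q)`:
`Pr[x ∧ y] · Pr[x ∨ y] = Pr[x] · Pr[y]`. [folklore] -/
theorem gnpWeight_inf_mul_sup (q : ℝ) (a b : (⊤ : SimpleGraph (Fin n)).edgeSet → Bool) :
    gnpWeight n q (a ⊓ b) * gnpWeight n q (a ⊔ b) = gnpWeight n q a * gnpWeight n q b := by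
  simp only [gnpWeight_eq_prod, ← prod_mul_distrib]
  refine prod_congr rfl fun e _ => ?_
  have h1 : (a ⊓ b) e = (a e && b e) := rfl
  have h2 : (a ⊔ b) e = (a e || b e) := rfl
  rw [h1, h2]
  cases a e <;> cases b e <;> simp [mul_comm]

/-- **Resampling the edges of `S`**: if `H` switches on every edge of `S`, the `G(n,q)`-mass of
the edge vectors agreeing with `H` off `S` is `Pr[G = H] / q^{|S|}` (independence of the edges).
[folklore] -/
theorem pow_mul_sum_agreeOff (q : ℝ) (S : Finset ((⊤ : SimpleGraph (Fin n)).edgeSet))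
    (H : (⊤ : SimpleGraph (Fin n)).edgeSet → Bool) (hH : ∀ e ∈ S, H e = true) :
    q ^ #S * ∑ x ∈ univ.filter (fun x : (⊤ : SimpleGraph (Fin n)).edgeSet → Bool =>
        ∀ e, e ∉ S → x e = H e), gnpWeight n q x = gnpWeight n q H := by
  classical
  rw [sum_filter]
  have key : ∀ x : (⊤ : SimpleGraph (Fin n)).edgeSet → Bool,
      (if ∀ e, e ∉ S → x e = H e then gnpWeight n q x else 0) =
        ∏ e, ((if x e = true then q else 1 - q) *
          (if e ∈ S then 1 else (if x e = H e then 1 else 0))) := by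
    intro x
    rw [prod_mul_distrib, ← gnpWeight_eq_prod]
    split_ifs with h
    · rw [prod_eq_one, mul_one]
      intro e _
      by_cases he : e ∈ S
      · rw [if_pos he]
      · rw [if_neg he, if_pos (h e he)]
    · push Not at h
      obtain ⟨e, heS, hxe⟩ := h
      rw [prod_eq_zero (mem_univ e), mul_zero]
      rw [if_neg heS, if_neg hxe]
  simp_rw [key]
  rw [sum_boolVec_prod (fun e b => (if b = true then q else 1 - q) *
    (if e ∈ S then (1 : ℝ) else (if b = H e then 1 else 0)))]
  calc _ = q ^ #S * ∏ e : (⊤ : SimpleGraph (Fin n)).edgeSet,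
        (if e ∈ S then (1 : ℝ) else (if H e = true then q else 1 - q)) := by
        congr 1
        refine prod_congr rfl fun e _ => ?_
        by_cases he : e ∈ S
        · simp [he]
        · cases H e <;> simp [he]
    _ = (∏ e ∈ univ.filter (fun e => e ∈ S), (if H e = true then q else 1 - q)) *
          ∏ e ∈ univ.filter (fun e => ¬ e ∈ S), (if H e = true then q else 1 - q) := by
        rw [prod_ite, prod_const_one, one_mul]
        congr 1
        rw [filter_univ_mem]
        calc q ^ #S = ∏ _e ∈ S, q := by rw [prod_const]
          _ = _ := prod_congr rfl fun e he => by rw [if_pos (hH e he)]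
    _ = gnpWeight n q H := by
        rw [prod_filter_mul_prod_filter_not, gnpWeight_eq_prod]

/-- **Union bound** for `G(n,q)`-probabilities of events given by predicates. [folklore] -/
theorem gnpProb_filter_le_sum {ι : Type*} {q : ℝ} (hq0 : 0 ≤ q) (hq1 : q ≤ 1) (T : Finset ι)
    (P : ((⊤ : SimpleGraph (Fin n)).edgeSet → Bool) → Prop) [DecidablePred P]
    (R : ι → ((⊤ : SimpleGraph (Fin n)).edgeSet → Bool) → Prop) [∀ i, DecidablePred (R i)]
    (h : ∀ x, P x → ∃ i ∈ T, R i x) :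
    gnpProb n q (univ.filter P) ≤ ∑ i ∈ T, gnpProb n q (univ.filter (R i)) := by
  simp only [gnpProb_filter]
  rw [sum_comm]
  refine sum_le_sum fun x _ => ?_
  split_ifs with hx
  · obtain ⟨i, hi, hR⟩ := h x hx
    calc gnpWeight n q x = (if R i x then gnpWeight n q x else 0) := by rw [if_pos hR]
      _ ≤ ∑ i ∈ T, (if R i x then gnpWeight n q x else 0) :=
        single_le_sum (f := fun j => if R j x then gnpWeight n q x else 0) (fun j _ => by
          split_ifs
          · exact gnpWeight_nonneg hq0 hq1 x
          · exact le_rfl) hi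
  · exact sum_nonneg fun j _ => by
      split_ifs
      · exact gnpWeight_nonneg hq0 hq1 x
      · exact le_rfl

/-- `Pr[S ⊆ E(G(n,q))] = q^{|S|}` in `gnpProb` form. [folklore] -/
theorem gnpProb_forall_mem (q : ℝ) (S : Finset ((⊤ : SimpleGraph (Fin n)).edgeSet)) :
    gnpProb n q (univ.filter fun x : (⊤ : SimpleGraph (Fin n)).edgeSet → Bool =>
      ∀ e ∈ S, x e = true) = q ^ #S := by
  rw [gnpProb]
  convert sum_gnpWeight_filter_forall q S using 2

/-- `Pr[K_A ⊆ G(n,q)] = q^{C(|A|,2)}`. [folklore] -/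
theorem gnpProb_sub (q : ℝ) (A : Finset (Fin n)) :
    gnpProb n q (univ.filter fun x : (⊤ : SimpleGraph (Fin n)).edgeSet → Bool =>
      ∀ e, cliqueVec A e = true → x e = true) = q ^ (#A).choose 2 := by
  classical
  rw [← card_filter_cliqueVec A, ← gnpProb_forall_mem]
  congr 1
  ext x
  simp only [mem_filter, mem_univ, true_and]


/-! ### Harris–FKG: `Pr[ω_k = 0] ≥ (1 - q^{C(k,2)})^{C(n,k)}` -/

/-- **Harris' inequality** for the product measure `G(n,q)`: two decreasing nonnegative functions
of the edge vector are positively correlated (Harris 1960; here from the FKG inequality, Mathlib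
`fkg`, on the order dual of the Boolean lattice of edge vectors, the `G(n,q)` weights being
log-modular). [folklore] -/
theorem harris_antitone {q : ℝ} (hq0 : 0 ≤ q) (hq1 : q ≤ 1)
    (f g : ((⊤ : SimpleGraph (Fin n)).edgeSet → Bool) → ℝ) (hf0 : 0 ≤ f) (hg0 : 0 ≤ g)
    (hf : Antitone f) (hg : Antitone g) :
    (∑ x, gnpWeight n q x * f x) * (∑ x, gnpWeight n q x * g x) ≤
      ∑ x, gnpWeight n q x * (f x * g x) := by
  have key := fkg (α := ((⊤ : SimpleGraph (Fin n)).edgeSet → Bool)ᵒᵈ) (β := ℝ)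
    (f ∘ OrderDual.ofDual) (g ∘ OrderDual.ofDual) (gnpWeight n q ∘ OrderDual.ofDual)
    (fun a => gnpWeight_nonneg hq0 hq1 _) (fun a => hf0 _) (fun a => hg0 _)
    (fun a b hab => hf (OrderDual.ofDual_le_ofDual.2 hab))
    (fun a b hab => hg (OrderDual.ofDual_le_ofDual.2 hab))
    (fun a b => by
      change gnpWeight n q (OrderDual.ofDual a) * gnpWeight n q (OrderDual.ofDual b) ≤
        gnpWeight n q (OrderDual.ofDual a ⊔ OrderDual.ofDual b) *
          gnpWeight n q (OrderDual.ofDual a ⊓ OrderDual.ofDual b)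
      rw [mul_comm (gnpWeight n q (_ ⊔ _)), gnpWeight_inf_mul_sup])
  have htot : ∑ a : ((⊤ : SimpleGraph (Fin n)).edgeSet → Bool)ᵒᵈ,
      (gnpWeight n q ∘ OrderDual.ofDual) a = 1 := sum_gnpWeight q
  rw [htot, one_mul] at key
  exact key

/-- The indicator of "`K_A ⊄ x`" is decreasing in `x`. [folklore] -/
theorem antitone_notSub (A : Finset (Fin n)) :
    Antitone fun x : (⊤ : SimpleGraph (Fin n)).edgeSet → Bool =>
      if ∀ e, cliqueVec A e = true → x e = true then (0 : ℝ) else 1 := by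
  intro x y hxy
  dsimp only
  by_cases hx : ∀ e, cliqueVec A e = true → x e = true
  · rw [if_pos hx, if_pos (sub_mono hxy hx)]
  · rw [if_neg hx]
    split_ifs <;> norm_num

/-- Janson/Harris lower bound for a family `𝓑` of `k`-sets:
`Pr[no A ∈ 𝓑 is a clique of G(n,q)] ≥ (1 - q^{C(k,2)})^{|𝓑|}`. [folklore] -/
theorem pow_le_sum_gnpWeight_prod_notSub {q : ℝ} (hq0 : 0 ≤ q) (hq1 : q ≤ 1) (k : ℕ)
    (𝓑 : Finset (Finset (Fin n))) (h𝓑 : 𝓑 ⊆ powersetCard k (univ : Finset (Fin n))) :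
    (1 - q ^ k.choose 2) ^ #𝓑 ≤
      ∑ x, gnpWeight n q x *
        ∏ A ∈ 𝓑, (if ∀ e, cliqueVec A e = true → x e = true then (0 : ℝ) else 1) := by
  classical
  induction 𝓑 using Finset.induction_on with
  | empty => simp [sum_gnpWeight]
  | insert A 𝓑 hA ih =>
    have h𝓑' : 𝓑 ⊆ powersetCard k univ := (subset_insert _ _).trans h𝓑
    have hAk : A ∈ powersetCard k (univ : Finset (Fin n)) := h𝓑 (mem_insert_self _ _)
    have hq : 0 ≤ 1 - q ^ k.choose 2 := sub_nonneg.2 (pow_le_one₀ hq0 hq1)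
    -- the one-set factor: `Pr[K_A ⊄ G] = 1 - q^{C(k,2)}`
    have hg : ∑ x, gnpWeight n q x *
        (if ∀ e, cliqueVec A e = true → x e = true then (0 : ℝ) else 1) =
          1 - q ^ k.choose 2 := by
      have h1 := gnpProb_sub (n := n) q A
      rw [(mem_powersetCard.1 hAk).2, gnpProb_filter] at h1
      have hsplit : ∀ x : (⊤ : SimpleGraph (Fin n)).edgeSet → Bool, gnpWeight n q x *
          (if (∀ e, cliqueVec A e = true → x e = true) then (0 : ℝ) else 1) =
            gnpWeight n q x -
              (if (∀ e, cliqueVec A e = true → x e = true) then gnpWeight n q x else 0) := by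
        intro x
        split_ifs <;> ring
      simp_rw [hsplit, sum_sub_distrib, sum_gnpWeight, h1]
    have hind : ∀ (B : Finset (Fin n)) (x : (⊤ : SimpleGraph (Fin n)).edgeSet → Bool),
        (0 : ℝ) ≤ if ∀ e, cliqueVec B e = true → x e = true then (0 : ℝ) else 1 := fun B x => by
      split_ifs <;> norm_num
    have hind0 : 0 ≤ fun x : (⊤ : SimpleGraph (Fin n)).edgeSet → Bool =>
        if ∀ e, cliqueVec A e = true → x e = true then (0 : ℝ) else 1 := fun x => hind A x
    have hprod0 : 0 ≤ fun x : (⊤ : SimpleGraph (Fin n)).edgeSet → Bool =>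
        ∏ B ∈ 𝓑, (if ∀ e, cliqueVec B e = true → x e = true then (0 : ℝ) else 1) := fun x =>
      prod_nonneg fun B _ => hind B x
    have hprodA : Antitone fun x : (⊤ : SimpleGraph (Fin n)).edgeSet → Bool =>
        ∏ B ∈ 𝓑, (if ∀ e, cliqueVec B e = true → x e = true then (0 : ℝ) else 1) :=
      fun x y hxy => Finset.prod_le_prod (fun B _ => hind B y) fun B _ => antitone_notSub B hxy
    rw [card_insert_of_notMem hA, pow_succ']
    simp_rw [prod_insert hA]
    calc (1 - q ^ k.choose 2) * (1 - q ^ k.choose 2) ^ #𝓑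
        ≤ (∑ x, gnpWeight n q x *
            (if ∀ e, cliqueVec A e = true → x e = true then (0 : ℝ) else 1)) *
          ∑ x, gnpWeight n q x *
            ∏ B ∈ 𝓑, (if ∀ e, cliqueVec B e = true → x e = true then (0 : ℝ) else 1) := by
          rw [hg]
          exact mul_le_mul_of_nonneg_left (ih h𝓑') hq
      _ ≤ _ := harris_antitone hq0 hq1 _ _ hind0 hprod0 (antitone_notSub A) hprodA

/-- **`Pr[ω_k(G(n,q)) = 0] ≥ (1 - q^{C(k,2)})^{C(n,k)}`** (Harris' inequality / the lower bound in
Janson's inequality; the paper's "`Pr[ω_k(G) = 0] ≥ Ω(1)` since `p` is a threshold function",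
App. B p. 14). [folklore] -/
theorem pow_le_gnpProb_cliqueCount_eq_zero {q : ℝ} (hq0 : 0 ≤ q) (hq1 : q ≤ 1) (k : ℕ) :
    (1 - q ^ k.choose 2) ^ n.choose k ≤
      gnpProb n q (univ.filter fun x => cliqueCount n k x = 0) := by
  have h := pow_le_sum_gnpWeight_prod_notSub (n := n) hq0 hq1 k (powersetCard k univ) subset_rfl
  rw [card_powersetCard, card_univ, Fintype.card_fin] at h
  rw [gnpProb_filter]
  convert h using 2 with x
  by_cases hx : cliqueCount n k x = 0
  · rw [if_pos hx, prod_eq_one (fun A hA => if_neg ((cliqueCount_eq_zero_iff' k x).1 hx A hA)),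
      mul_one]
  · rw [if_neg hx]
    rw [cliqueCount_eq_zero_iff'] at hx
    push Not at hx
    obtain ⟨A, hA, hsub⟩ := hx
    rw [prod_eq_zero hA, mul_zero]
    exact if_pos hsub


/-! ### The two conditional laws: total mass and the resampling identity -/

/-- Total mass of the planted numerators:
`∑_H ∑_A Pr[ω_k(G) = 0 ∧ G ∪ K_A = H] = C(n,k) · Pr[ω_k(G) = 0]`. [folklore] -/
theorem sum_inner_eq (k : ℕ) (q : ℝ) :
    ∑ H : (⊤ : SimpleGraph (Fin n)).edgeSet → Bool, ∑ A ∈ powersetCard k (univ : Finset (Fin n)),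
        gnpProb n q (univ.filter fun x => cliqueCount n k x = 0 ∧ plantClique A x = H) =
      (n.choose k : ℝ) * gnpProb n q (univ.filter fun x => cliqueCount n k x = 0) := by
  rw [sum_comm]
  have inner : ∀ A ∈ powersetCard k (univ : Finset (Fin n)),
      ∑ H : (⊤ : SimpleGraph (Fin n)).edgeSet → Bool,
        gnpProb n q (univ.filter fun x => cliqueCount n k x = 0 ∧ plantClique A x = H) =
      gnpProb n q (univ.filter fun x => cliqueCount n k x = 0) := by
    intro A _
    simp only [gnpProb_filter]
    rw [sum_comm]
    refine sum_congr rfl fun x _ => ?_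
    by_cases hx : cliqueCount n k x = 0 <;> simp [hx]
  rw [sum_congr rfl inner, sum_const, card_powersetCard, card_univ, Fintype.card_fin,
    nsmul_eq_mul]

/-- The planted numerators summed over the graphs `H` with `ω_k(H) ≠ 1`:
`∑_{ω_k(H) ≠ 1} ∑_A Pr[ω_k(G) = 0 ∧ G ∪ K_A = H] = ∑_A Pr[ω_k(G) = 0 ∧ ω_k(G ∪ K_A) ≠ 1]`.
[folklore] -/
theorem sum_filter_inner_eq (k : ℕ) (q : ℝ) :
    ∑ H ∈ univ.filter (fun H : (⊤ : SimpleGraph (Fin n)).edgeSet → Bool =>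
        ¬ cliqueCount n k H = 1),
      ∑ A ∈ powersetCard k (univ : Finset (Fin n)),
        gnpProb n q (univ.filter fun x => cliqueCount n k x = 0 ∧ plantClique A x = H) =
      ∑ A ∈ powersetCard k (univ : Finset (Fin n)),
        gnpProb n q (univ.filter fun x =>
          cliqueCount n k x = 0 ∧ cliqueCount n k (plantClique A x) ≠ 1) := by
  rw [sum_comm]
  refine sum_congr rfl fun A _ => ?_
  simp only [gnpProb_filter]
  rw [sum_comm]
  refine sum_congr rfl fun x _ => ?_
  rw [sum_filter, sum_eq_single_of_mem (plantClique A x) (mem_univ _)]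
  · by_cases h0 : cliqueCount n k x = 0 <;>
      by_cases h1 : cliqueCount n k (plantClique A x) = 1 <;> simp [h0, h1]
  · intro H _ hH
    simp [hH.symm]

/-- **Resampling identity** (the computation behind (c) and the Bayes step of Rossman 2010,
App. B, p. 13–14): if `H` has exactly one `k`-clique then
`q^{C(k,2)} · ∑_A Pr[ω_k(G) = 0 ∧ G ∪ K_A = H] = Pr[G = H] · (1 - q^{C(k,2)})` — only the clique
`B` of `H` contributes, and `{G : ω_k(G) = 0, G ∪ K_B = H}` is the set of graphs agreeing with `H`
off `K_B`, minus `H` itself. [cite: Rossman2010, Lemma 23 (App. B, p. 13–14)] -/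
theorem pow_mul_inner_eq {k : ℕ} (q : ℝ) {H : (⊤ : SimpleGraph (Fin n)).edgeSet → Bool}
    (hH : cliqueCount n k H = 1) :
    q ^ k.choose 2 * ∑ A ∈ powersetCard k (univ : Finset (Fin n)),
        gnpProb n q (univ.filter fun x => cliqueCount n k x = 0 ∧ plantClique A x = H) =
      gnpWeight n q H * (1 - q ^ k.choose 2) := by
  obtain ⟨B, hB⟩ := (cliqueCount_eq_one_iff k H).1 hH
  have hBmem : B ∈ powersetCard k (univ : Finset (Fin n)) ∧
      ∀ e, cliqueVec B e = true → H e = true := (hB B).2 rfl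
  have huniq : ∀ A ∈ powersetCard k (univ : Finset (Fin n)),
      (∀ e, cliqueVec A e = true → H e = true) → A = B := fun A hA hs => (hB A).1 ⟨hA, hs⟩
  rw [sum_eq_single_of_mem B hBmem.1 (fun A hA hAB => ?_)]
  swap
  · rw [gnpProb, sum_eq_zero]
    intro x hx
    exfalso
    rw [mem_filter] at hx
    exact hAB (huniq A hA ((plantClique_eq_iff A x H).1 hx.2.2).1)
  -- the edges of `K_B`
  set S : Finset ((⊤ : SimpleGraph (Fin n)).edgeSet) := univ.filter fun e => cliqueVec B e = true
    with hS
  have hScard : #S = k.choose 2 := by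
    rw [hS, card_filter_cliqueVec, (mem_powersetCard.1 hBmem.1).2]
  have hHS : ∀ e ∈ S, H e = true := fun e he => hBmem.2 e (mem_filter.1 he).2
  have hnotS : ∀ e, e ∉ S ↔ cliqueVec B e = false := fun e => by simp [hS]
  have hres := pow_mul_sum_agreeOff q S H hHS
  rw [hScard] at hres
  have hHmem : H ∈ univ.filter (fun x : (⊤ : SimpleGraph (Fin n)).edgeSet → Bool =>
      ∀ e, e ∉ S → x e = H e) := mem_filter.2 ⟨mem_univ _, fun e _ => rfl⟩
  -- the set identity
  have hset : (univ.filter fun x => cliqueCount n k x = 0 ∧ plantClique B x = H) =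
      (univ.filter fun x : (⊤ : SimpleGraph (Fin n)).edgeSet → Bool =>
        ∀ e, e ∉ S → x e = H e) \ {H} := by
    ext x
    simp only [Finset.mem_sdiff, Finset.mem_filter, Finset.mem_univ, true_and,
      Finset.mem_singleton]
    constructor
    · rintro ⟨h0, hpl⟩
      have hpl' := (plantClique_eq_iff B x H).1 hpl
      refine ⟨fun e he => hpl'.2 e ((hnotS e).1 he), ?_⟩
      rintro rfl
      rw [hH] at h0
      exact one_ne_zero h0
    · rintro ⟨hagree, hne⟩
      have hplant : plantClique B x = H :=
        (plantClique_eq_iff B x H).2 ⟨hBmem.2, fun e he => hagree e ((hnotS e).2 he)⟩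
      refine ⟨?_, hplant⟩
      rw [cliqueCount_eq_zero_iff']
      intro A hA hsub
      have hAH : ∀ e, cliqueVec A e = true → H e = true :=
        sub_mono (hplant ▸ le_plantClique B x) hsub
      have hAB := huniq A hA hAH
      rw [hAB] at hsub
      apply hne
      funext e
      by_cases he : cliqueVec B e = true
      · rw [hsub e he, hBmem.2 e he]
      · exact hagree e ((hnotS e).2 (by simpa using he))
  rw [hset, gnpProb, sum_sdiff_eq_sub (singleton_subset_iff.2 hHmem), sum_singleton, mul_sub, hres]
  ring

/-- The real-algebra behind the total-variation identity: if `P = 𝟙_{one} w / O` and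
`Q = inner / NZ` with `inner = c · w` on `one`, `∑ inner = NZ` and `Bad = ∑_{¬ one} inner`, then
`∑ |P - Q| = 2 · Bad / NZ`. [folklore] -/
theorem tv_algebra {ι : Type*} [Fintype ι] (one : ι → Prop) [DecidablePred one]
    (w inner : ι → ℝ) (O NZ c Bad : ℝ)
    (hO : ∑ i, (if one i then w i else 0) = O) (hOpos : 0 < O) (hNZ : 0 < NZ)
    (hw : ∀ i, 0 ≤ w i) (hinner0 : ∀ i, 0 ≤ inner i) (hinner1 : ∀ i, one i → inner i = w i * c)
    (hBad : ∑ i ∈ univ.filter (fun i => ¬ one i), inner i = Bad) (htot : ∑ i, inner i = NZ) :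
    ∑ i, |(if one i then w i else 0) / O - inner i / NZ| = 2 * Bad / NZ := by
  have hO' : ∑ i ∈ univ.filter one, w i = O := by rw [← hO, sum_filter]
  have hOc : ∑ i ∈ univ.filter one, inner i = O * c := by
    rw [← hO', sum_mul]
    exact sum_congr rfl fun i hi => hinner1 i (mem_filter.1 hi).2
  have hrel : O * c + Bad = NZ := by
    rw [← htot, ← sum_filter_add_sum_filter_not univ one inner, hOc, hBad]
  have hBad0 : 0 ≤ Bad := hBad ▸ sum_nonneg fun i _ => hinner0 i
  rw [← sum_filter_add_sum_filter_not univ one]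
  have h1 : ∑ i ∈ univ.filter one, |(if one i then w i else 0) / O - inner i / NZ| =
      |1 - O * c / NZ| := by
    have key : ∀ i ∈ univ.filter one,
        |(if one i then w i else 0) / O - inner i / NZ| = w i * |1 / O - c / NZ| := by
      intro i hi
      rw [mem_filter] at hi
      rw [if_pos hi.2, hinner1 i hi.2,
        show w i / O - w i * c / NZ = w i * (1 / O - c / NZ) by ring, abs_mul,
        abs_of_nonneg (hw i)]
    rw [sum_congr rfl key, ← sum_mul, hO']
    calc O * |1 / O - c / NZ| = |O| * |1 / O - c / NZ| := by rw [abs_of_pos hOpos]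
      _ = |O * (1 / O - c / NZ)| := (abs_mul _ _).symm
      _ = |1 - O * c / NZ| := by
          congr 1
          field_simp
  have h2 : ∑ i ∈ univ.filter (fun i => ¬ one i),
      |(if one i then w i else 0) / O - inner i / NZ| = Bad / NZ := by
    have key : ∀ i ∈ univ.filter (fun i => ¬ one i),
        |(if one i then w i else 0) / O - inner i / NZ| = inner i / NZ := by
      intro i hi
      rw [mem_filter] at hi
      rw [if_neg hi.2, zero_div, zero_sub, abs_neg, abs_of_nonneg (div_nonneg (hinner0 i) hNZ.le)]
    rw [sum_congr rfl key, ← sum_div, hBad]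
  rw [h1, h2, show O * c = NZ - Bad by linarith,
    show 1 - (NZ - Bad) / NZ = Bad / NZ by field_simp; ring,
    abs_of_nonneg (div_nonneg hBad0 hNZ.le)]
  ring

/-- The clique vector `K_A` of a `k`-set, `k ≥ 2`, has exactly one `k`-clique. [folklore] -/
theorem cliqueCount_cliqueVec {k : ℕ} (hk : 2 ≤ k) {A : Finset (Fin n)}
    (hA : A ∈ powersetCard k (univ : Finset (Fin n))) : cliqueCount n k (cliqueVec A) = 1 := by
  rw [cliqueCount_eq_one_iff]
  refine ⟨A, fun B => ⟨fun hB => ?_, ?_⟩⟩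
  swap
  · rintro rfl
    exact ⟨hA, fun e he => he⟩
  obtain ⟨hB, hsub⟩ := hB
  have hBk := (mem_powersetCard.1 hB).2
  have hAk := (mem_powersetCard.1 hA).2
  have hsubset : B ⊆ A := by
    intro u hu
    obtain ⟨a, ha, b, hb, hab⟩ := one_lt_card.1 (by omega : 1 < #B)
    obtain ⟨v, hv, huv⟩ : ∃ v ∈ B, u ≠ v := by
      by_cases h : u = a
      · exact ⟨b, hb, fun hub => hab (h.symm.trans hub)⟩
      · exact ⟨a, ha, h⟩
    have he : s(u, v) ∈ (⊤ : SimpleGraph (Fin n)).edgeSet := by simpa using huv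
    have h1 : cliqueVec B ⟨s(u, v), he⟩ = true := by
      simp only [cliqueVec, Sym2.mem_iff, forall_eq_or_imp, forall_eq, decide_eq_true_eq]
      exact ⟨hu, hv⟩
    have h2 := hsub _ h1
    simp only [cliqueVec, Sym2.mem_iff, forall_eq_or_imp, forall_eq, decide_eq_true_eq] at h2
    exact h2.1
  exact eq_of_subset_of_card_le hsubset (by omega)

/-- The `G(n,q)` weights are positive for `0 < q < 1`. [folklore] -/
theorem gnpWeight_pos {q : ℝ} (hq0 : 0 < q) (hq1 : q < 1)
    (x : (⊤ : SimpleGraph (Fin n)).edgeSet → Bool) : 0 < gnpWeight n q x :=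
  mul_pos (pow_pos hq0 _) (pow_pos (sub_pos.2 hq1) _)

/-- `Pr[ω_k(G(n,q)) = 1] > 0` for `0 < q < 1` and `2 ≤ k ≤ n` (witness: a single `k`-clique).
[folklore] -/
theorem gnpProb_cliqueCount_eq_one_pos {k : ℕ} {q : ℝ} (hq0 : 0 < q) (hq1 : q < 1)
    (hk : 2 ≤ k) (hkn : k ≤ n) :
    0 < gnpProb n q (univ.filter fun x => cliqueCount n k x = 1) := by
  obtain ⟨A, hA⟩ : (powersetCard k (univ : Finset (Fin n))).Nonempty :=
    powersetCard_nonempty.2 (by simpa using hkn)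
  have hmem : cliqueVec A ∈ univ.filter
      (fun x : (⊤ : SimpleGraph (Fin n)).edgeSet → Bool => cliqueCount n k x = 1) :=
    mem_filter.2 ⟨mem_univ _, cliqueCount_cliqueVec hk hA⟩
  exact lt_of_lt_of_le (gnpWeight_pos hq0 hq1 _)
    (single_le_sum (f := gnpWeight n q) (fun x _ => gnpWeight_nonneg hq0.le hq1.le x) hmem)

/-- **The total-variation identity** (Rossman 2010, App. B, p. 13: "the total variation distance
between distributions (i) and (ii) is easily seen to equal …", made exact): for `0 < q < 1` and
`2 ≤ k ≤ n`,
`∑_H |Pr[G = H | ω_k = 1] - Pr[G ∪ K_A = H | ω_k(G) = 0]| = 2 · Pr[ω_k(G ∪ K_A) ≠ 1 | ω_k(G) = 0]`,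
the right side written as `2 · (∑_A Pr[ω_k(G) = 0 ∧ ω_k(G ∪ K_A) ≠ 1]) / (C(n,k) · Pr[ω_k(G) = 0])`.
[cite: Rossman2010, Lemma 23 (App. B, p. 13)] -/
theorem tv_eq {k : ℕ} {q : ℝ} (hq0 : 0 < q) (hq1 : q < 1) (hk : 2 ≤ k) (hkn : k ≤ n) :
    ∑ H, |condOneCliqueLaw n k q H - plantedCliqueFreeLaw n k q H| =
      2 * (∑ A ∈ powersetCard k (univ : Finset (Fin n)),
        gnpProb n q (univ.filter fun x =>
          cliqueCount n k x = 0 ∧ cliqueCount n k (plantClique A x) ≠ 1)) /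
        ((n.choose k : ℝ) * gnpProb n q (univ.filter fun x => cliqueCount n k x = 0)) := by
  have hKpos : 0 < k.choose 2 := Nat.choose_pos hk
  have hqK1 : q ^ k.choose 2 < 1 := pow_lt_one₀ hq0.le hq1 hKpos.ne'
  have hqK0 : 0 < q ^ k.choose 2 := pow_pos hq0 _
  have hZ : 0 < gnpProb n q (univ.filter fun x => cliqueCount n k x = 0) :=
    lt_of_lt_of_le (pow_pos (sub_pos.2 hqK1) _) (pow_le_gnpProb_cliqueCount_eq_zero hq0.le hq1.le k)
  have hN : (0 : ℝ) < n.choose k := by exact_mod_cast Nat.choose_pos hkn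
  have hO := gnpProb_cliqueCount_eq_one_pos (n := n) hq0 hq1 hk hkn
  simp only [condOneCliqueLaw, plantedCliqueFreeLaw]
  refine tv_algebra (fun H => cliqueCount n k H = 1) (gnpWeight n q)
    (fun H => ∑ A ∈ powersetCard k (univ : Finset (Fin n)),
      gnpProb n q (univ.filter fun x => cliqueCount n k x = 0 ∧ plantClique A x = H))
    _ _ ((1 - q ^ k.choose 2) / q ^ k.choose 2) _ (gnpProb_filter q _).symm hO (mul_pos hN hZ)
    (gnpWeight_nonneg hq0.le hq1.le) (fun H => sum_nonneg fun A _ =>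
      gnpProb_nonneg hq0.le hq1.le _) (fun H hH1 => ?_) (sum_filter_inner_eq k q)
    (sum_inner_eq k q)
  rw [← mul_div_assoc, eq_div_iff hqK0.ne', mul_comm]
  exact pow_mul_inner_eq q hH1


/-! ### (a): the union bound over second cliques overlapping the planted one -/

/-- For a `k`-set `A`:
`Pr[ω_k(G) = 0 ∧ ω_k(G ∪ K_A) ≠ 1] ≤ ∑_{j=2}^{k-1} C(k,j) C(n,k-j) q^{C(k,2)-C(j,2)}` — a second
`k`-clique `B` of `G ∪ K_A` has `2 ≤ |A ∩ B| ≤ k - 1` (else it would be a clique of `G`) and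
`K_B ∖ K_A ⊆ G`, an event of probability `q^{C(k,2) - C(|A ∩ B|,2)}`; this is computation (a) of
Rossman 2010, App. B, p. 14, for the joint event (so Harris' inequality is not needed), with
`C(n-k, k-j)` relaxed to `C(n, k-j)`. [cite: Rossman2010, Lemma 23 (App. B, (a), p. 14)] -/
theorem gnpProb_bad_le {k : ℕ} {q : ℝ} (hq0 : 0 ≤ q) (hq1 : q ≤ 1) {A : Finset (Fin n)}
    (hA : A ∈ powersetCard k (univ : Finset (Fin n))) :
    gnpProb n q (univ.filter fun x =>
        cliqueCount n k x = 0 ∧ cliqueCount n k (plantClique A x) ≠ 1) ≤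
      ∑ j ∈ Ico 2 k, ((k.choose j * n.choose (k - j) : ℕ) : ℝ) *
        q ^ (k.choose 2 - j.choose 2) := by
  have hAk : #A = k := (mem_powersetCard.1 hA).2
  -- step 1: union bound over the candidate second cliques `B`
  have step1 : gnpProb n q (univ.filter fun x =>
        cliqueCount n k x = 0 ∧ cliqueCount n k (plantClique A x) ≠ 1) ≤
      ∑ B ∈ (powersetCard k (univ : Finset (Fin n))).filter (fun B => #(A ∩ B) ∈ Ico 2 k),
        gnpProb n q (univ.filter fun x : (⊤ : SimpleGraph (Fin n)).edgeSet → Bool =>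
          ∀ e ∈ (univ.filter fun e : (⊤ : SimpleGraph (Fin n)).edgeSet =>
            cliqueVec B e = true ∧ ¬ cliqueVec A e = true), x e = true) := by
    refine gnpProb_filter_le_sum hq0 hq1 _ _ _ (fun x hx => ?_)
    obtain ⟨h0, h1⟩ := hx
    obtain ⟨B, hB, hBA, hsub⟩ := exists_ne_sub_plantClique hA h1
    refine ⟨B, ?_, ?_⟩
    · rw [mem_filter, mem_Ico]
      refine ⟨hB, ?_, card_inter_lt_of_ne hA hB hBA⟩
      by_contra hlt
      push Not at hlt
      exact (cliqueCount_eq_zero_iff' k x).1 h0 B hB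
        (sub_of_sub_plantClique_of_card_le_one hsub (by omega))
    · intro e he
      rw [mem_filter] at he
      exact sub_diff_of_sub_plantClique hsub e he.2.1 (by simpa using he.2.2)
  refine step1.trans ?_
  -- step 2: each term is `q^{C(k,2) - C(|A ∩ B|, 2)}`
  have step2 : ∀ B ∈ (powersetCard k (univ : Finset (Fin n))).filter
      (fun B => #(A ∩ B) ∈ Ico 2 k),
      gnpProb n q (univ.filter fun x : (⊤ : SimpleGraph (Fin n)).edgeSet → Bool =>
          ∀ e ∈ (univ.filter fun e : (⊤ : SimpleGraph (Fin n)).edgeSet =>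
            cliqueVec B e = true ∧ ¬ cliqueVec A e = true), x e = true) =
        q ^ (k.choose 2 - (#(A ∩ B)).choose 2) := by
    intro B hB
    rw [gnpProb_forall_mem]
    congr 1
    have hBk : #B = k := (mem_powersetCard.1 (mem_filter.1 hB).1).2
    have h1 : #(univ.filter fun e : (⊤ : SimpleGraph (Fin n)).edgeSet => cliqueVec B e = true) =
        k.choose 2 := by rw [card_filter_cliqueVec, hBk]
    have h2 : #((univ.filter fun e : (⊤ : SimpleGraph (Fin n)).edgeSet =>
        cliqueVec B e = true).filter fun e => cliqueVec A e = true) = (#(A ∩ B)).choose 2 := by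
      rw [← card_filter_cliqueVec (A ∩ B), filter_filter]
      congr 1
      ext e
      simp only [mem_filter, mem_univ, true_and, cliqueVec_inter, Bool.and_eq_true]
      tauto
    have h3 := Finset.card_filter_add_card_filter_not
      (s := univ.filter fun e : (⊤ : SimpleGraph (Fin n)).edgeSet => cliqueVec B e = true)
      (fun e => cliqueVec A e = true)
    rw [h2, h1, filter_filter] at h3
    omega
  rw [sum_congr rfl step2]
  -- step 3: group by `j = |A ∩ B|` and count the fibres
  have hmaps : ∀ B ∈ (powersetCard k (univ : Finset (Fin n))).filter
      (fun B => #(A ∩ B) ∈ Ico 2 k), (fun B => #(A ∩ B)) B ∈ Ico 2 k :=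
    fun B hB => (mem_filter.1 hB).2
  rw [← sum_fiberwise_of_maps_to' hmaps (fun j => q ^ (k.choose 2 - j.choose 2))]
  refine sum_le_sum fun j _ => ?_
  rw [sum_const, nsmul_eq_mul]
  refine mul_le_mul_of_nonneg_right ?_ (pow_nonneg hq0 _)
  have hcard : #(((powersetCard k (univ : Finset (Fin n))).filter
      (fun B => #(A ∩ B) ∈ Ico 2 k)).filter fun B => #(A ∩ B) = j) ≤
        k.choose j * n.choose (k - j) := by
    calc #(((powersetCard k (univ : Finset (Fin n))).filter
          (fun B => #(A ∩ B) ∈ Ico 2 k)).filter fun B => #(A ∩ B) = j)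
        ≤ #((powersetCard j A) ×ˢ (powersetCard (k - j) (univ : Finset (Fin n)))) := by
          refine card_le_card_of_injOn (fun B => (A ∩ B, B \ A)) (fun B hB => ?_)
            (fun B₁ _ B₂ _ h => ?_)
          · have hB' := hB
            simp only [mem_coe, mem_filter] at hB'
            obtain ⟨⟨hB𝒜, _⟩, hj⟩ := hB'
            have hBk : #B = k := (mem_powersetCard.1 hB𝒜).2
            simp only [mem_coe, mem_product, mem_powersetCard]
            refine ⟨⟨inter_subset_left, hj⟩, subset_univ _, ?_⟩
            have := card_sdiff_add_card_inter B A
            rw [inter_comm] at hj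
            omega
          · simp only [Prod.mk.injEq] at h
            ext v
            by_cases hv : v ∈ A
            · have h' := congrArg (v ∈ ·) h.1
              simp only [Finset.mem_inter, hv, true_and] at h'
              exact Iff.of_eq h'
            · have h' := congrArg (v ∈ ·) h.2
              simp only [Finset.mem_sdiff, hv, not_false_eq_true, and_true] at h'
              exact Iff.of_eq h'
      _ = k.choose j * n.choose (k - j) := by
          rw [card_product, card_powersetCard, card_powersetCard, hAk, card_univ,
            Fintype.card_fin]
  exact_mod_cast hcard

/-! ### Asymptotics at the threshold and the proof of Lemma 23 -/

end Rossman2010L23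

open Rossman2010L23 in
/-- **Rossman 2010, Lemma 23 — discharged** (`Rossman2010_plantedVsConditioned`). Proof
(following App. B, pp. 13–14 of the paper, in the finite-sum model of `G(n,p)`): by the
resampling identity the two conditional laws agree up to the constant factor
`r = Pr[ω_k = 1](1 - p^K) / (p^K C(n,k) Pr[ω_k = 0])` on the graphs with exactly one `k`-clique,
whence the exact identity `TV = 2 · Pr[ω_k(G ∪ K_A) ≠ 1 | ω_k(G) = 0]` (`tv_eq`); the joint event
is bounded by the union bound (a) over second cliques `B` with `2 ≤ |A ∩ B| ≤ k-1`
(`gnpProb_bad_le`), each term `C(k,j) C(n,k-j) p^{C(k,2)-C(j,2)} = O(n^{-j(k-j)/(k-1)}) → 0` for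
`p = Θ(n^{-2/(k-1)})`, while `Pr[ω_k(G) = 0] ≥ (1 - p^{C(k,2)})^{C(n,k)} ≥ exp(-2 c^{C(k,2)})`
stays bounded below by Harris' inequality (`pow_le_gnpProb_cliqueCount_eq_zero`, from Mathlib's
`fkg`) since `C(n,k) p^{C(k,2)} ≤ c^{C(k,2)}`. [cite: Rossman2010, Lemma 23 (App. B, pp. 13–14)] -/
theorem Rossman2010_plantedVsConditioned_holds : Rossman2010_plantedVsConditioned := by
  intro k hk p hp hΘ
  have hk2 : 2 ≤ k := by omega
  have hk1 : (1 : ℝ) < k := by exact_mod_cast (show 1 < k by omega)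
  have hk1' : (k : ℝ) - 1 ≠ 0 := (sub_pos.2 hk1).ne'
  have hKpos : 0 < k.choose 2 := Nat.choose_pos hk2
  -- the threshold function is positive and tends to `0`
  have hθpos : ∀ n : ℕ, 1 ≤ n → 0 < (n : ℝ) ^ (-(2 : ℝ) / ((k : ℝ) - 1)) := fun n hn =>
    Real.rpow_pos_of_pos (by exact_mod_cast hn) _
  have hθ0 : Tendsto (fun n : ℕ => (n : ℝ) ^ (-(2 : ℝ) / ((k : ℝ) - 1))) atTop (𝓝 0) := by
    have hpos : 0 < (2 : ℝ) / ((k : ℝ) - 1) := div_pos two_pos (by linarith)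
    refine ((tendsto_rpow_neg_atTop hpos).comp tendsto_natCast_atTop_atTop).congr fun n => ?_
    simp only [Function.comp_apply, neg_div]
  -- the constants of `p = Θ(n^{-2/(k-1)})`
  obtain ⟨c, hc, hpc⟩ := hΘ.1.exists_pos
  obtain ⟨c', hc', hpc'⟩ := hΘ.2.exists_pos
  rw [isBigOWith_iff] at hpc hpc'
  have hp_le : ∀ᶠ n : ℕ in atTop, p n ≤ c * (n : ℝ) ^ (-(2 : ℝ) / ((k : ℝ) - 1)) := by
    filter_upwards [hpc, eventually_ge_atTop 1] with n hn hn1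
    rwa [Real.norm_of_nonneg (hp n).1, Real.norm_of_nonneg (hθpos n hn1).le] at hn
  have hp_pos : ∀ᶠ n : ℕ in atTop, 0 < p n := by
    filter_upwards [hpc', eventually_ge_atTop 1] with n hn hn1
    rw [Real.norm_of_nonneg (hp n).1, Real.norm_of_nonneg (hθpos n hn1).le] at hn
    by_contra hle
    push Not at hle
    have h0 : p n = 0 := le_antisymm hle (hp n).1
    rw [h0, mul_zero] at hn
    exact absurd hn (not_le.2 (hθpos n hn1))
  have hp_tendsto : Tendsto p atTop (𝓝 0) := by
    refine squeeze_zero' (Eventually.of_forall fun n => (hp n).1) hp_le ?_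
    simpa using hθ0.const_mul c
  have hp_half : ∀ᶠ n : ℕ in atTop, p n ≤ 1 / 2 := hp_tendsto.eventually_le_const (by norm_num)
  -- `μ = C(n,k) p^{C(k,2)} ≤ c^{C(k,2)}`
  have hμ : ∀ᶠ n : ℕ in atTop, (n.choose k : ℝ) * p n ^ k.choose 2 ≤ c ^ k.choose 2 := by
    filter_upwards [hp_le, eventually_ge_atTop 1] with n hn hn1
    have hn0 : (0 : ℝ) < n := by exact_mod_cast hn1
    have h1 : (n.choose k : ℝ) ≤ (n : ℝ) ^ (k : ℝ) := by
      rw [Real.rpow_natCast]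
      exact_mod_cast Nat.choose_le_pow n k
    have h2 : p n ^ k.choose 2 ≤ (c * (n : ℝ) ^ (-(2 : ℝ) / ((k : ℝ) - 1))) ^ k.choose 2 :=
      pow_le_pow_left₀ (hp n).1 hn _
    have h3 : (c * (n : ℝ) ^ (-(2 : ℝ) / ((k : ℝ) - 1))) ^ k.choose 2 =
        c ^ k.choose 2 * (n : ℝ) ^ (-(k : ℝ)) := by
      rw [mul_pow, ← Real.rpow_mul_natCast hn0.le]
      congr 2
      rw [Nat.cast_choose_two]
      field_simp
    calc (n.choose k : ℝ) * p n ^ k.choose 2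
        ≤ (n : ℝ) ^ (k : ℝ) * (c ^ k.choose 2 * (n : ℝ) ^ (-(k : ℝ))) :=
          mul_le_mul h1 (h2.trans_eq h3) (pow_nonneg (hp n).1 _) (by positivity)
      _ = c ^ k.choose 2 := by
          rw [mul_left_comm, ← Real.rpow_add hn0, add_neg_cancel, Real.rpow_zero, mul_one]
  -- `exp(-2t) ≤ 1 - t` on `[0, 1/2]`
  have hexp2 : ∀ t : ℝ, 0 ≤ t → t ≤ 1 / 2 → Real.exp (-(2 * t)) ≤ 1 - t := by
    intro t ht0 ht
    have h1 : 1 + 2 * t ≤ Real.exp (2 * t) := by linarith [Real.add_one_le_exp (2 * t)]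
    have h2 : 0 < 1 + 2 * t := by linarith
    rw [Real.exp_neg]
    calc (Real.exp (2 * t))⁻¹ ≤ (1 + 2 * t)⁻¹ := inv_anti₀ h2 h1
      _ ≤ 1 - t := by
          rw [inv_eq_one_div, div_le_iff₀ h2]
          nlinarith
  -- Harris: `Pr[ω_k(G) = 0] ≥ exp(-2 c^{C(k,2)})` eventually
  have hZ : ∀ᶠ n : ℕ in atTop, Real.exp (-(2 * c ^ k.choose 2)) ≤
      gnpProb n (p n) (univ.filter fun x => cliqueCount n k x = 0) := by
    filter_upwards [hμ, hp_half] with n hn hhalf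
    have ht0 : 0 ≤ p n ^ k.choose 2 := pow_nonneg (hp n).1 _
    have ht : p n ^ k.choose 2 ≤ 1 / 2 :=
      (pow_le_of_le_one (hp n).1 (hp n).2 hKpos.ne').trans hhalf
    calc Real.exp (-(2 * c ^ k.choose 2))
        ≤ Real.exp (-(2 * ((n.choose k : ℝ) * p n ^ k.choose 2))) :=
          Real.exp_le_exp.2 (by nlinarith)
      _ = Real.exp (-(2 * p n ^ k.choose 2)) ^ n.choose k := by
          rw [← Real.exp_nat_mul]
          congr 1
          ring
      _ ≤ (1 - p n ^ k.choose 2) ^ n.choose k :=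
          pow_le_pow_left₀ (Real.exp_pos _).le (hexp2 _ ht0 ht) _
      _ ≤ _ := pow_le_gnpProb_cliqueCount_eq_zero (hp n).1 (hp n).2 k
  -- the union bound tends to `0`, term by term
  have hbound : Tendsto (fun n : ℕ => ∑ j ∈ Ico 2 k,
      ((k.choose j * n.choose (k - j) : ℕ) : ℝ) * p n ^ (k.choose 2 - j.choose 2)) atTop (𝓝 0) := by
    have hterm : ∀ j ∈ Ico 2 k, Tendsto (fun n : ℕ =>
        ((k.choose j * n.choose (k - j) : ℕ) : ℝ) * p n ^ (k.choose 2 - j.choose 2))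
          atTop (𝓝 0) := by
      intro j hj
      rw [mem_Ico] at hj
      have hjK : j.choose 2 ≤ k.choose 2 := Nat.choose_le_choose 2 hj.2.le
      have hexp : ((k - j : ℕ) : ℝ) +
          -(2 : ℝ) / ((k : ℝ) - 1) * ((k.choose 2 - j.choose 2 : ℕ) : ℝ) =
          -((j : ℝ) * ((k : ℝ) - j) / ((k : ℝ) - 1)) := by
        rw [Nat.cast_sub hjK, Nat.cast_choose_two, Nat.cast_choose_two, Nat.cast_sub hj.2.le]
        field_simp
        ring
      have hj2 : (2 : ℝ) ≤ j := by exact_mod_cast hj.1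
      have hjk : (j : ℝ) < k := by exact_mod_cast hj.2
      have hneg : 0 < (j : ℝ) * ((k : ℝ) - j) / ((k : ℝ) - 1) :=
        div_pos (mul_pos (by linarith) (by linarith)) (by linarith)
      have hlim : Tendsto (fun n : ℕ => (n : ℝ) ^ (-((j : ℝ) * ((k : ℝ) - j) / ((k : ℝ) - 1))))
          atTop (𝓝 0) :=
        (tendsto_rpow_neg_atTop hneg).comp tendsto_natCast_atTop_atTop
      have hlim' := hlim.const_mul ((k.choose j : ℝ) * c ^ (k.choose 2 - j.choose 2))
      rw [mul_zero] at hlim'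
      refine squeeze_zero' (Eventually.of_forall fun n =>
        mul_nonneg (Nat.cast_nonneg _) (pow_nonneg (hp n).1 _)) ?_ hlim'
      filter_upwards [hp_le, eventually_ge_atTop 1] with n hn hn1
      have hn0 : (0 : ℝ) < n := by exact_mod_cast hn1
      have h1 : ((k.choose j * n.choose (k - j) : ℕ) : ℝ) ≤
          (k.choose j : ℝ) * (n : ℝ) ^ ((k - j : ℕ) : ℝ) := by
        rw [Real.rpow_natCast]
        push_cast
        exact mul_le_mul_of_nonneg_left (by exact_mod_cast Nat.choose_le_pow n (k - j))
          (Nat.cast_nonneg _)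
      have h2 : p n ^ (k.choose 2 - j.choose 2) ≤ c ^ (k.choose 2 - j.choose 2) *
          ((n : ℝ) ^ (-(2 : ℝ) / ((k : ℝ) - 1))) ^ (k.choose 2 - j.choose 2) := by
        rw [← mul_pow]
        exact pow_le_pow_left₀ (hp n).1 hn _
      calc ((k.choose j * n.choose (k - j) : ℕ) : ℝ) * p n ^ (k.choose 2 - j.choose 2)
          ≤ (k.choose j : ℝ) * (n : ℝ) ^ ((k - j : ℕ) : ℝ) * (c ^ (k.choose 2 - j.choose 2) *
              ((n : ℝ) ^ (-(2 : ℝ) / ((k : ℝ) - 1))) ^ (k.choose 2 - j.choose 2)) :=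
            mul_le_mul h1 h2 (pow_nonneg (hp n).1 _) (by positivity)
        _ = (k.choose j : ℝ) * c ^ (k.choose 2 - j.choose 2) *
              (n : ℝ) ^ (-((j : ℝ) * ((k : ℝ) - j) / ((k : ℝ) - 1))) := by
            rw [← Real.rpow_mul_natCast hn0.le, ← hexp, Real.rpow_add hn0]
            ring
    have := tendsto_finsetSum (Ico 2 k) hterm
    simpa using this
  -- assembly: `TV = 2 Bad / (C(n,k) Z) ≤ 2 exp(2 c^{C(k,2)}) · bound → 0`
  have hlimR := hbound.const_mul (2 * Real.exp (2 * c ^ k.choose 2))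
  rw [mul_zero] at hlimR
  refine squeeze_zero' (Eventually.of_forall fun n => sum_nonneg fun H _ => abs_nonneg _) ?_ hlimR
  filter_upwards [hZ, hp_pos, hp_half, eventually_ge_atTop k] with n hZn hp0 hhalf hkn
  have hp1 : p n < 1 := by linarith
  rw [tv_eq hp0 hp1 hk2 hkn]
  have hN : (0 : ℝ) < n.choose k := by exact_mod_cast Nat.choose_pos hkn
  have hZpos : 0 < gnpProb n (p n) (univ.filter fun x => cliqueCount n k x = 0) :=
    lt_of_lt_of_le (Real.exp_pos _) hZn
  have hBad : ∑ A ∈ powersetCard k (univ : Finset (Fin n)),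
      gnpProb n (p n) (univ.filter fun x =>
        cliqueCount n k x = 0 ∧ cliqueCount n k (plantClique A x) ≠ 1) ≤
      (n.choose k : ℝ) * ∑ j ∈ Ico 2 k,
        ((k.choose j * n.choose (k - j) : ℕ) : ℝ) * p n ^ (k.choose 2 - j.choose 2) := by
    refine (sum_le_sum fun A hA => gnpProb_bad_le (hp n).1 (hp n).2 hA).trans ?_
    rw [sum_const, card_powersetCard, card_univ, Fintype.card_fin, nsmul_eq_mul]
  have hBad0 : 0 ≤ ∑ A ∈ powersetCard k (univ : Finset (Fin n)),
      gnpProb n (p n) (univ.filter fun x =>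
        cliqueCount n k x = 0 ∧ cliqueCount n k (plantClique A x) ≠ 1) :=
    sum_nonneg fun A _ => gnpProb_nonneg (hp n).1 (hp n).2 _
  have hb0 : 0 ≤ ∑ j ∈ Ico 2 k,
      ((k.choose j * n.choose (k - j) : ℕ) : ℝ) * p n ^ (k.choose 2 - j.choose 2) :=
    sum_nonneg fun j _ => mul_nonneg (Nat.cast_nonneg _) (pow_nonneg (hp n).1 _)
  calc 2 * (∑ A ∈ powersetCard k (univ : Finset (Fin n)),
        gnpProb n (p n) (univ.filter fun x =>
          cliqueCount n k x = 0 ∧ cliqueCount n k (plantClique A x) ≠ 1)) /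
        ((n.choose k : ℝ) * gnpProb n (p n) (univ.filter fun x => cliqueCount n k x = 0))
      ≤ 2 * ((n.choose k : ℝ) * ∑ j ∈ Ico 2 k,
          ((k.choose j * n.choose (k - j) : ℕ) : ℝ) * p n ^ (k.choose 2 - j.choose 2)) /
        ((n.choose k : ℝ) * gnpProb n (p n) (univ.filter fun x => cliqueCount n k x = 0)) := by
        gcongr
    _ = 2 * (∑ j ∈ Ico 2 k,
          ((k.choose j * n.choose (k - j) : ℕ) : ℝ) * p n ^ (k.choose 2 - j.choose 2)) /
        gnpProb n (p n) (univ.filter fun x => cliqueCount n k x = 0) := by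
        rw [mul_left_comm, mul_div_mul_left _ _ hN.ne']
    _ ≤ 2 * (∑ j ∈ Ico 2 k,
          ((k.choose j * n.choose (k - j) : ℕ) : ℝ) * p n ^ (k.choose 2 - j.choose 2)) /
        Real.exp (-(2 * c ^ k.choose 2)) :=
        div_le_div_of_nonneg_left (by positivity) (Real.exp_pos _) hZn
    _ = 2 * Real.exp (2 * c ^ k.choose 2) * ∑ j ∈ Ico 2 k,
          ((k.choose j * n.choose (k - j) : ℕ) : ℝ) * p n ^ (k.choose 2 - j.choose 2) := by
        rw [Real.exp_neg, div_inv_eq_mul]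
        ring

end Literature.Computability.Complexity
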